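import Mathlib
import HarnessLib
import Summits.HubbardSuperconductivity.HubbardSuperconductivity.Theorems.KLProgrammeKLRegimeVolumeLimitZeroCoupling
import Summits.HubbardSuperconductivity.HubbardSuperconductivity.Theorems.KLProgrammeKLRegimeVolumeLimitFrameModulus

/-!
# Route `KLProgramme` — crux K3, child «VolumeLimit» (gen 4: stmt-HubbardSuperconductivity-19858 `KLRegimeVolumeLimitV12`):
# the ZERO-COUPLING WITNESS of the two-volume-rate stub — at `U = 0` the carrier obeys `stub_vl_twoVolumeRate`'s inequality with
# rate `ρ ≡ 0`, explicit modulus, NO thresholds (cell gate-hubbard-kl, seat hubbard-kl-k3c4-p1 g3, technique «volume lemmas»)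

WHY.  The registered stub `…Theorems.KLRegimeVolumeLimit.stub_vl_twoVolumeRate` of the VL skeleton «cauchy» asks, beyond thresholds, for
`‖Σ̂_{L,M}((ω,k),σ) − Σ̂_{L′,M′}((ω′,k′),σ)‖ ≤ ρ L + D·Σ_i |p_k i − p′_{k′} i|_𝕋` at equal Matsubara integers.  At `U = 0` the carrier is known
in closed form (k3c5-p2, `…VolumeLimitZeroCoupling.klSelfEnergy_nScales_succ_zero_coupling`): `Σ̂₀((ω,k),σ) = K(p_k)(−iω + e_K(p_k))/(−iω + ξ(p_k))`
— a GRID-EXACT family read from a `2πℤ²`-periodic function of the momentum, so its two-volume rate is `0` and its modulus is the torus-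
Lipschitz constant of that function (`…VolumeLimitCauchyTermwise.twoVolumeRate_of_gridExact`'s mechanism).  This module makes the constant
explicit — the order-`U⁰` witness that the stub's grammar (two cutoffs, two grids, equal Matsubara integers) is met by the true carrier at
EVERY `L, L′ ≥ 1`, `M, M′ ≥ 1`:

* `klvz_abs_torusBand_sub_le` — `|ε_L(k) − ε_{L′}(k′)| ≤ 2·Σ_i |p_k i − p′_{k′} i|_𝕋` (cosine is `1`-Lipschitz and `2π`-periodic), hence the
  same for `ξ = ε − μ` (`klvz_abs_nambuXi_sub_le`);
* `klvz_abs_eval_sub_le_of_frameOK` — `|K(p_k) − K(p′_{k′})| ≤ (2 + 7√2)·Σ_i |…|_𝕋` for an admissible frame (`K = ξ − e_K`,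
  `…VolumeLimitFrameModulus.klvf_abs_nambuXiCT_sub_le_of_frameOK`);
* `klvz_norm_closedForm_sub_le` — the algebra: `φ = a − a²/D` with `|a| ≤ A`, `‖D‖ ≥ d > 0` ⇒
  `‖φ₁ − φ₂‖ ≤ |a₁ − a₂|·(1 + 2A/d) + A²·‖D₁ − D₂‖/d²`;
* **`zeroCoupling_twoVolumeRate`** — for `0 < β`, any `μ`, any frame `K` whose values on momenta are torus-Lipschitz with constant `La`:
  `‖Σ̂₀^{L,M}((ω,k),σ) − Σ̂₀^{L′,M′}((ω′,k′),σ)‖ ≤ 0 + [La(1 + 2‖K‖₀β/π) + 2‖K‖₀²(β/π)²]·Σ_i |p_k i − p′_{k′} i|_𝕋` (all volumes and cutoffs,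
  equal Matsubara integers), and **`zeroCoupling_twoVolumeRate_of_frameOK`** (`La = 2 + 7√2` for `FrameOK` frames).

Everything PROVED; no definition, no named fact; nothing is asserted about the model at `U ≠ 0`.
-/

noncomputable section

namespace Summit.HubbardSuperconductivity.HubbardSuperconductivity.Theorems.KLRegimeSplit

set_option linter.dupNamespace false -- summit = problem name (single-conjunct summit), D-0017

open Real Finset Literature.MathematicalPhysics.QuantumLattice Literature.Probability.LatticeModels
open Literature.MathematicalPhysics.QuantumLattice.FermiRG
open Summit.HubbardSuperconductivity.HubbardSuperconductivity.Theorems.KLProgrammeLegKernels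

/-! ## §1 Torus moduli of the bare band, of `ξ`, and of the frame's values -/

/-- `|cos a − cos b| ≤ |a − b|_𝕋` (cosine is `1`-Lipschitz and `2π`-periodic). [folklore] -/
theorem klvz_abs_cos_sub_cos_le_torusAbs (a b : ℝ) : |Real.cos a - Real.cos b| ≤ torusAbs (a - b) := by
  obtain ⟨m, hm⟩ := klvc_exists_int_mul_abs_eq_torusAbs (a - b)
  have hcos : Real.cos b = Real.cos (b + m * (2 * Real.pi)) := (Real.cos_add_int_mul_two_pi b m).symm
  rw [hcos, ← hm]
  have h := Real.abs_cos_sub_cos_le a (b + m * (2 * Real.pi))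
  rwa [show a - (b + m * (2 * Real.pi)) = a - b - m * (2 * Real.pi) by ring] at h

/-- **The bare band across volumes**: `|ε_L(k) − ε_{L′}(k′)| ≤ 2·Σ_i |p_k i − p′_{k′} i|_𝕋`. [folklore] -/
theorem klvz_abs_torusBand_sub_le {L L' : ℕ} (k : TorusSite 2 L) (k' : TorusSite 2 L') :
    |torusBand L k - torusBand L' k'| ≤ 2 * ∑ i, torusAbs (latticeMomentum L k i - latticeMomentum L' k' i) := by
  have hdiff : torusBand L k - torusBand L' k' =
      -2 * ∑ i, (Real.cos (latticeMomentum L k i) - Real.cos (latticeMomentum L' k' i)) := by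
    simp only [torusBand]; rw [Finset.sum_sub_distrib]; ring
  rw [hdiff, abs_mul, abs_neg, abs_two]
  refine mul_le_mul_of_nonneg_left ?_ (by norm_num)
  exact (Finset.abs_sum_le_sum_abs _ _).trans (Finset.sum_le_sum fun i _ => klvz_abs_cos_sub_cos_le_torusAbs _ _)

/-- `ξ = ε − μ` across volumes: `|ξ_L(k) − ξ_{L′}(k′)| ≤ 2·Σ_i |p_k i − p′_{k′} i|_𝕋`. [folklore] -/
theorem klvz_abs_nambuXi_sub_le {L L' : ℕ} (μ : ℝ) (k : TorusSite 2 L) (k' : TorusSite 2 L') :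
    |nambuXi L μ k - nambuXi L' μ k'| ≤ 2 * ∑ i, torusAbs (latticeMomentum L k i - latticeMomentum L' k' i) := by
  simp only [nambuXi]
  rw [show torusBand L k - μ - (torusBand L' k' - μ) = torusBand L k - torusBand L' k' by ring]
  exact klvz_abs_torusBand_sub_le k k'

/-- **The frame's values across volumes**: for an admissible frame, `|K(p_k) − K(p′_{k′})| ≤ (2 + 7√2)·Σ_i |p_k i − p′_{k′} i|_𝕋`
(`K(p) = ξ(p) − e_K(p)`). [folklore] -/
theorem klvz_abs_eval_sub_le_of_frameOK {L L' : ℕ} [NeZero L] [NeZero L'] {R : RenConsts} {U : ℝ} {N : ℕ} {μ : ℝ}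
    {K : TrigPolyC4v} (hK : FrameOK R U N μ K) (k : TorusSite 2 L) (k' : TorusSite 2 L') :
    |K.eval (latticeMomentum L k) - K.eval (latticeMomentum L' k')| ≤
      (2 + 7 * Real.sqrt 2) * ∑ i, torusAbs (latticeMomentum L k i - latticeMomentum L' k' i) := by
  have h1 := klvz_abs_nambuXi_sub_le μ k k'
  have h2 := klvf_abs_nambuXiCT_sub_le_of_frameOK hK k k'
  have he : K.eval (latticeMomentum L k) - K.eval (latticeMomentum L' k') =
      (nambuXi L μ k - nambuXi L' μ k') - (nambuXiCT L μ K k - nambuXiCT L' μ K k') := by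
    rw [nambuXi_eq_nambuXiCT_add L μ K k, nambuXi_eq_nambuXiCT_add L' μ K k']; ring
  rw [he, add_mul]
  exact (abs_sub _ _).trans (add_le_add h1 h2)

/-! ## §2 The algebra of the closed form `φ = a(D − a)/D = a − a²/D` -/

/-- For reals `a₁ a₂` with `|aᵢ| ≤ A` and complex `D₁ D₂` with `‖Dᵢ‖ ≥ d > 0`:
`‖a₁(D₁ − a₁)/D₁ − a₂(D₂ − a₂)/D₂‖ ≤ |a₁ − a₂|(1 + 2A/d) + A²‖D₁ − D₂‖/d²`. [folklore] -/
theorem klvz_norm_closedForm_sub_le {a₁ a₂ A d : ℝ} {D₁ D₂ : ℂ} (hd : 0 < d) (hA₁ : |a₁| ≤ A) (hA₂ : |a₂| ≤ A)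
    (hD₁ : d ≤ ‖D₁‖) (hD₂ : d ≤ ‖D₂‖) :
    ‖(a₁ : ℂ) * (D₁ - a₁) / D₁ - (a₂ : ℂ) * (D₂ - a₂) / D₂‖ ≤
      |a₁ - a₂| * (1 + 2 * A / d) + A ^ 2 * ‖D₁ - D₂‖ / d ^ 2 := by
  have hA0 : 0 ≤ A := (abs_nonneg _).trans hA₁
  have hD₁0 : D₁ ≠ 0 := fun h => by rw [h, norm_zero] at hD₁; linarith
  have hD₂0 : D₂ ≠ 0 := fun h => by rw [h, norm_zero] at hD₂; linarith
  have hD₁pos : 0 < ‖D₁‖ := lt_of_lt_of_le hd hD₁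
  have hD₂pos : 0 < ‖D₂‖ := lt_of_lt_of_le hd hD₂
  -- `φ = a − a²/D`
  have hφ : ∀ (a : ℝ) (D : ℂ), D ≠ 0 → (a : ℂ) * (D - a) / D = (a : ℂ) - (a : ℂ) ^ 2 / D := fun a D hD => by
    field_simp
  rw [hφ a₁ D₁ hD₁0, hφ a₂ D₂ hD₂0]
  have hsplit : ((a₁ : ℂ) - (a₁ : ℂ) ^ 2 / D₁) - ((a₂ : ℂ) - (a₂ : ℂ) ^ 2 / D₂) =
      ((a₁ - a₂ : ℝ) : ℂ) - (((a₁ - a₂ : ℝ) : ℂ) * ((a₁ + a₂ : ℝ) : ℂ) / D₁ + (a₂ : ℂ) ^ 2 * (D₂ - D₁) / (D₁ * D₂)) := by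
    push_cast; field_simp; ring
  rw [hsplit]
  have h1 : ‖((a₁ - a₂ : ℝ) : ℂ)‖ = |a₁ - a₂| := by rw [Complex.norm_real, Real.norm_eq_abs]
  have h2 : ‖((a₁ - a₂ : ℝ) : ℂ) * ((a₁ + a₂ : ℝ) : ℂ) / D₁‖ ≤ |a₁ - a₂| * (2 * A) / d := by
    rw [norm_div, norm_mul, Complex.norm_real, Complex.norm_real, Real.norm_eq_abs, Real.norm_eq_abs]
    have hsum : |a₁ + a₂| ≤ 2 * A := (abs_add_le _ _).trans (by linarith)
    calc |a₁ - a₂| * |a₁ + a₂| / ‖D₁‖ ≤ |a₁ - a₂| * (2 * A) / ‖D₁‖ := by gcongr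
      _ ≤ |a₁ - a₂| * (2 * A) / d := div_le_div_of_nonneg_left (by positivity) hd hD₁
  have h3 : ‖(a₂ : ℂ) ^ 2 * (D₂ - D₁) / (D₁ * D₂)‖ ≤ A ^ 2 * ‖D₁ - D₂‖ / d ^ 2 := by
    rw [norm_div, norm_mul, norm_mul, norm_pow, Complex.norm_real, Real.norm_eq_abs, norm_sub_rev]
    have hsq : |a₂| ^ 2 ≤ A ^ 2 := pow_le_pow_left₀ (abs_nonneg _) hA₂ 2
    calc |a₂| ^ 2 * ‖D₁ - D₂‖ / (‖D₁‖ * ‖D₂‖) ≤ A ^ 2 * ‖D₁ - D₂‖ / (‖D₁‖ * ‖D₂‖) := by gcongr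
      _ ≤ A ^ 2 * ‖D₁ - D₂‖ / d ^ 2 := by
          rw [sq d]
          exact div_le_div_of_nonneg_left (by positivity) (by positivity) (mul_le_mul hD₁ hD₂ hd.le (norm_nonneg _))
  calc ‖((a₁ - a₂ : ℝ) : ℂ) - (((a₁ - a₂ : ℝ) : ℂ) * ((a₁ + a₂ : ℝ) : ℂ) / D₁ + (a₂ : ℂ) ^ 2 * (D₂ - D₁) / (D₁ * D₂))‖
      ≤ ‖((a₁ - a₂ : ℝ) : ℂ)‖ + (‖((a₁ - a₂ : ℝ) : ℂ) * ((a₁ + a₂ : ℝ) : ℂ) / D₁‖ + ‖(a₂ : ℂ) ^ 2 * (D₂ - D₁) / (D₁ * D₂)‖) :=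
        (norm_sub_le _ _).trans (add_le_add le_rfl (norm_add_le _ _))
    _ ≤ |a₁ - a₂| + (|a₁ - a₂| * (2 * A) / d + A ^ 2 * ‖D₁ - D₂‖ / d ^ 2) := by rw [h1]; gcongr
    _ = |a₁ - a₂| * (1 + 2 * A / d) + A ^ 2 * ‖D₁ - D₂‖ / d ^ 2 := by ring

/-! ## §3 The witness: the carrier at `U = 0` has two-volume rate `0` and an explicit modulus, at every volume and cutoff -/

/-- **ZERO-COUPLING WITNESS of `stub_vl_twoVolumeRate`'s inequality.**  For `0 < β`, any `μ`, and a frame `K` whose values on momenta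
are torus-Lipschitz across grids with constant `La` (`|K(p_k) − K(p′_{k′})| ≤ La·Σ_i |p_k i − p′_{k′} i|_𝕋`; `La = 2 + 7√2` for
admissible frames, below), the two-leg vertex function of the fully integrated countertermed action AT `U = 0` satisfies, for ALL
`L, L′, M, M′ ≥ 1`, every spin, all frequency labels with the same Matsubara integer and all torus momenta:
`‖Σ̂₀^{L,M}((ω,k),σ) − Σ̂₀^{L′,M′}((ω′,k′),σ)‖ ≤ 0 + [La·(1 + 2‖K‖₀·β/π) + ‖K‖₀²·2·(β/π)²] · Σ_i |p_k i − p′_{k′} i|_𝕋`. [folklore] -/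
theorem zeroCoupling_twoVolumeRate {β : ℝ} (hβ : 0 < β) (μ : ℝ) (K : TrigPolyC4v) {La : ℝ}
    (hLa : ∀ (L L' : ℕ) [NeZero L] [NeZero L'] (k : TorusSite 2 L) (k' : TorusSite 2 L'),
      |K.eval (latticeMomentum L k) - K.eval (latticeMomentum L' k')| ≤
        La * ∑ i, torusAbs (latticeMomentum L k i - latticeMomentum L' k' i)) :
    ∀ (L : ℕ) [NeZero L], 0 ≤ L → ∀ (M : ℕ) [NeZero M], (fun _ : ℕ => 0) L ≤ M →
      ∀ (L' : ℕ) [NeZero L'], L ≤ L' → ∀ (M' : ℕ) [NeZero M'], (fun _ : ℕ => 0) L' ≤ M' →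
        ∀ (σ : Fin 2) (ω : MatsubaraIdx M) (ω' : MatsubaraIdx M'), matsubaraInt M ω = matsubaraInt M' ω' →
          ∀ (k : TorusSite 2 L) (k' : TorusSite 2 L'),
            ‖klSelfEnergy L M β 0 μ K klE0 (nScales β + 1) (ω, k) σ -
                klSelfEnergy L' M' β 0 μ K klE0 (nScales β + 1) (ω', k') σ‖ ≤
              (fun _ : ℕ => (0 : ℝ)) L +
                (La * (1 + 2 * K.coeffNorm 0 / (Real.pi / β)) + K.coeffNorm 0 ^ 2 * 2 / (Real.pi / β) ^ 2) *
                  ∑ i, torusAbs (latticeMomentum L k i - latticeMomentum L' k' i) := by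
  intro L _ _ M _ _ L' _ _ M' _ _ σ ω ω' hωω' k k'
  rw [TwoPointAssembly.klSelfEnergy_nScales_succ_zero_coupling hβ μ K (ω, k) σ,
    TwoPointAssembly.klSelfEnergy_nScales_succ_zero_coupling hβ μ K (ω', k') σ]
  simp only
  rw [klvf_matsubaraFreq_eq_of_matsubaraInt_eq β hωω']
  set w : ℝ := matsubaraFreq β M' ω' with hw
  set x : ℝ := ∑ i, torusAbs (latticeMomentum L k i - latticeMomentum L' k' i) with hx
  have hx0 : 0 ≤ x := klvc_tmod_nonneg _ _
  set a₁ : ℝ := K.eval (latticeMomentum L k) with ha₁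
  set a₂ : ℝ := K.eval (latticeMomentum L' k') with ha₂
  set D₁ : ℂ := -Complex.I * (w : ℂ) + (nambuXiCT L μ 0 k : ℂ) with hD₁
  set D₂ : ℂ := -Complex.I * (w : ℂ) + (nambuXiCT L' μ 0 k' : ℂ) with hD₂
  -- the numerators are `Dᵢ − aᵢ`
  have hn₁ : -Complex.I * (w : ℂ) + (nambuXiCT L μ K k : ℂ) = D₁ - a₁ := by
    rw [hD₁, ha₁, nambuXiCT_zero_frame, nambuXi_eq_nambuXiCT_add L μ K k]; push_cast; ring
  have hn₂ : -Complex.I * (w : ℂ) + (nambuXiCT L' μ K k' : ℂ) = D₂ - a₂ := by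
    rw [hD₂, ha₂, nambuXiCT_zero_frame, nambuXi_eq_nambuXiCT_add L' μ K k']; push_cast; ring
  rw [hn₁, hn₂]
  -- the data of `klvz_norm_closedForm_sub_le`
  have hπβ : 0 < Real.pi / β := div_pos Real.pi_pos hβ
  have hwabs : Real.pi / β ≤ |w| := pi_div_le_abs_matsubaraFreq hβ ω'
  have hDim : ∀ (c : ℝ), Real.pi / β ≤ ‖-Complex.I * (w : ℂ) + (c : ℂ)‖ := fun c => by
    have him : (-Complex.I * (w : ℂ) + (c : ℂ)).im = -w := by simp
    calc Real.pi / β ≤ |w| := hwabs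
      _ = |(-Complex.I * (w : ℂ) + (c : ℂ)).im| := by rw [him, abs_neg]
      _ ≤ _ := Complex.abs_im_le_norm _
  have hA₁ : |a₁| ≤ K.coeffNorm 0 := TrigPolyC4v.abs_eval_le_coeffNorm K _
  have hA₂ : |a₂| ≤ K.coeffNorm 0 := TrigPolyC4v.abs_eval_le_coeffNorm K _
  have hDD : ‖D₁ - D₂‖ ≤ 2 * x := by
    have : D₁ - D₂ = ((nambuXi L μ k - nambuXi L' μ k' : ℝ) : ℂ) := by
      rw [hD₁, hD₂, nambuXiCT_zero_frame, nambuXiCT_zero_frame]; push_cast; ring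
    rw [this, Complex.norm_real, Real.norm_eq_abs]
    exact klvz_abs_nambuXi_sub_le μ k k'
  have h := klvz_norm_closedForm_sub_le (D₁ := D₁) (D₂ := D₂) hπβ hA₁ hA₂ (hDim _) (hDim _)
  have haa : |a₁ - a₂| ≤ La * x := hLa L L' k k'
  have hK0 : 0 ≤ K.coeffNorm 0 := TrigPolyC4v.coeffNorm_nonneg 0 K
  have hLa0 : 0 ≤ La * x := (abs_nonneg _).trans haa
  calc ‖(a₁ : ℂ) * (D₁ - a₁) / D₁ - (a₂ : ℂ) * (D₂ - a₂) / D₂‖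
      ≤ |a₁ - a₂| * (1 + 2 * K.coeffNorm 0 / (Real.pi / β)) + K.coeffNorm 0 ^ 2 * ‖D₁ - D₂‖ / (Real.pi / β) ^ 2 := h
    _ ≤ La * x * (1 + 2 * K.coeffNorm 0 / (Real.pi / β)) + K.coeffNorm 0 ^ 2 * (2 * x) / (Real.pi / β) ^ 2 := by
        gcongr
    _ = 0 + (La * (1 + 2 * K.coeffNorm 0 / (Real.pi / β)) + K.coeffNorm 0 ^ 2 * 2 / (Real.pi / β) ^ 2) * x := by ring

/-- **The zero-coupling witness for admissible frames**: `FrameOK R U N μ K` ⇒ the above with `La = 2 + 7√2` — at `U = 0` the carrier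
meets `stub_vl_twoVolumeRate`'s inequality with `ρ ≡ 0`, thresholds `0`, and `D = (2 + 7√2)(1 + 2‖K‖₀β/π) + 2‖K‖₀²(β/π)²`. [folklore] -/
theorem zeroCoupling_twoVolumeRate_of_frameOK {β : ℝ} (hβ : 0 < β) {R : RenConsts} {U : ℝ} {N : ℕ} {μ : ℝ} {K : TrigPolyC4v}
    (hK : FrameOK R U N μ K) :
    ∀ (L : ℕ) [NeZero L], 0 ≤ L → ∀ (M : ℕ) [NeZero M], (fun _ : ℕ => 0) L ≤ M →
      ∀ (L' : ℕ) [NeZero L'], L ≤ L' → ∀ (M' : ℕ) [NeZero M'], (fun _ : ℕ => 0) L' ≤ M' →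
        ∀ (σ : Fin 2) (ω : MatsubaraIdx M) (ω' : MatsubaraIdx M'), matsubaraInt M ω = matsubaraInt M' ω' →
          ∀ (k : TorusSite 2 L) (k' : TorusSite 2 L'),
            ‖klSelfEnergy L M β 0 μ K klE0 (nScales β + 1) (ω, k) σ -
                klSelfEnergy L' M' β 0 μ K klE0 (nScales β + 1) (ω', k') σ‖ ≤
              (fun _ : ℕ => (0 : ℝ)) L +
                ((2 + 7 * Real.sqrt 2) * (1 + 2 * K.coeffNorm 0 / (Real.pi / β)) + K.coeffNorm 0 ^ 2 * 2 / (Real.pi / β) ^ 2) *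
                  ∑ i, torusAbs (latticeMomentum L k i - latticeMomentum L' k' i) :=
  zeroCoupling_twoVolumeRate hβ μ K fun _ _ _ _ k k' => klvz_abs_eval_sub_le_of_frameOK hK k k'

end Summit.HubbardSuperconductivity.HubbardSuperconductivity.Theorems.KLRegimeSplit
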